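import Mathlib
import HarnessLib
import Summits.NavierStokesRegularity.NavierStokesRegularity.Theorems.HalfSpaceWindowDoorCirculationCarryingRigidityAngularFlux
import Summits.NavierStokesRegularity.NavierStokesRegularity.Theorems.AxisTwistDoorAveragedConeLiouvilleCircMonotone

/-!
# Route `HalfSpaceWindowDoor`, crux `CirculationCarryingRigidity` (stmt-NavierStokesRegularity-25311) —
# line `angular_flux` (LEAD ns-hsw-p1 g13): POLOIDAL profiles have (r,z)-DIVERGENCE-FREE angular-momentum flux

Corollary of the conservative circle law `…AngularFlux.circ_conservation_law_of_class` for the sister crux 19708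
(`PoloidalWindowDoor`, poloidal door-class profiles `⟪curl v, e₃⟫ ≡ 0`) and for the conclusion side of W6: if `ω₃ ≡ 0` then
`Γ ≡ 0` on every axis circle (`…CircMonotone.circ_eq_integral_vortCirc`), hence the velocity-only fluxes satisfy
`∂ᵣS + r⁻¹S + ∂_zP = 0` at every `s < 0`, `r ≠ 0`, `z` (`fluxDiv_eq_zero_of_poloidal`): the pair `(rS, rP)` of angular-momentum
fluxes `S = ∮v_r v_θ dl`, `P = ∮v₃ v_θ dl` of a poloidal profile is divergence-free in the meridian half-plane although `v_θ` itself
need not vanish (non-axisymmetric poloidal fields carry eddy swirl with zero circle mean).  Sign-free; imports no route file.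

Seat ns-hsw-p1 g13, `--supports stmt-NavierStokesRegularity-25311 --as helper`.  WHAT THIS IS NOT: not about NS regularity; circle
bookkeeping for HYPOTHETICAL profiles; nothing is closed by this file.
-/

noncomputable section

-- the summit and its single sub-problem share the name (CONVENTIONS §1), as in every Theorems file
set_option linter.dupNamespace false

namespace Summit.NavierStokesRegularity.NavierStokesRegularity.Theorems.HalfSpaceWindowDoorCirculationCarryingRigidityAngularFluxPoloidal

open scoped Topology InnerProductSpace RealInnerProductSpace
open Set Function MeasureTheory intervalIntegral Filter
open Literature.Analysis Literature.Analysis.UnboundedOperators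
open Literature.Analysis.FluidPDE hiding eR
open Summit.NavierStokesRegularity.NavierStokesRegularity.Theorems.AxisTwistDoorAveragedConeLiouvilleDefs (cylPt eR eT e3 circ vortCirc)
open Summit.NavierStokesRegularity.NavierStokesRegularity.Theorems.AveragedConeLiouville.CircMonotone (circ_eq_integral_vortCirc)
open Summit.NavierStokesRegularity.NavierStokesRegularity.Theorems
  (exists_isClassicalNSSolutionOn_Iio_of_isTypeIAncientMild)
open Summit.NavierStokesRegularity.NavierStokesRegularity.Theorems.PoloidalWindowDoorPoloidalWindowRigidityWindow
  (isTypeIAncientMild_of_class)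
open Summit.NavierStokesRegularity.NavierStokesRegularity.Theorems.HalfSpaceWindowDoorCirculationCarryingRigidityAngularFlux
  (circ_conservation_law)

variable {v : ℝ → EuclideanSpace ℝ (Fin 3) → EuclideanSpace ℝ (Fin 3)}

/-- A poloidal `C¹` slice (`⟪curl v(s), e₃⟫ ≡ 0`) has zero circulation on every axis circle: `Γ(r,z,s) = 0`. -/
theorem circ_eq_zero_of_poloidal {s : ℝ} (hv : ContDiff ℝ 1 (v s)) (hpol : ∀ y, ⟪curl (v s) y, e3⟫_ℝ = 0) (r z : ℝ) :
    circ v r z s = 0 := by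
  rw [circ_eq_integral_vortCirc v hv z r]
  have : ∀ ρ : ℝ, vortCirc v ρ z s = 0 := fun ρ => by
    unfold vortCirc
    simp [hpol]
  simp [this]

/-- **POLOIDAL ⇒ (r,z)-DIVERGENCE-FREE ANGULAR-MOMENTUM FLUX.**  For a poloidal profile of the door's Type-I ancient Oseen-mild
class (the four class fields spelled out) and every `s < 0`, `r ≠ 0`, `z`:
`∂ᵣS + r⁻¹S + ∂_zP = 0`, `S = ∫₀^{2π}⟪v,e_r⟫⟪v,e_θ⟫ r dθ`, `P = ∫₀^{2π}⟪v,e₃⟫⟪v,e_θ⟫ r dθ`. -/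
theorem fluxDiv_eq_zero_of_poloidal {C : ℝ} (hrate : HasTypeITimeDecay C v)
    (hcont : ContinuousOn (uncurry v) (Iio (0 : ℝ) ×ˢ univ))
    (hmild : ∀ s t : ℝ, s < t → t < 0 → ∀ x, v t x = heatExtension (v s) (t - s) x - oseenDuhamel 1 s v v t x)
    (hdiv : ∀ t < 0, VectorCalculus.IsDivFree (v t))
    (hpol : ∀ s < 0, ∀ y, ⟪curl (v s) y, e3⟫_ℝ = 0) {s : ℝ} (hs : s < 0) {r : ℝ} (hr : r ≠ 0) (z : ℝ) :
    deriv (fun r' => ∫ θ in (0 : ℝ)..(2 * Real.pi), ⟪v s (cylPt r' θ z), eR θ⟫_ℝ * ⟪v s (cylPt r' θ z), eT θ⟫_ℝ * r') r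
        + r⁻¹ * (∫ θ in (0 : ℝ)..(2 * Real.pi), ⟪v s (cylPt r θ z), eR θ⟫_ℝ * ⟪v s (cylPt r θ z), eT θ⟫_ℝ * r)
        + deriv (fun z' => ∫ θ in (0 : ℝ)..(2 * Real.pi), ⟪v s (cylPt r θ z'), e3⟫_ℝ * ⟪v s (cylPt r θ z'), eT θ⟫_ℝ * r) z
      = 0 := by
  obtain ⟨p, hcl⟩ := exists_isClassicalNSSolutionOn_Iio_of_isTypeIAncientMild
    (isTypeIAncientMild_of_class hrate hcont hmild hdiv)
  have hlaw := circ_conservation_law isOpen_Iio hcl hs hr z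
  -- `Γ ≡ 0` on the whole open slab
  have hzero : ∀ s' < (0 : ℝ), ∀ r' z' : ℝ, circ v r' z' s' = 0 := fun s' hs' r' z' =>
    circ_eq_zero_of_poloidal ((hcl.contDiff_velocity hs').of_le (by norm_cast)) (hpol s' hs') r' z'
  -- hence every derivative of `Γ` in the law vanishes
  have h_s : deriv (fun s' => circ v r z s') s = 0 := by
    have heq : (fun s' => circ v r z s') =ᶠ[𝓝 s] fun _ => (0 : ℝ) :=
      (eventually_lt_nhds hs).mono fun s' hs' => hzero s' hs' r z
    rw [heq.deriv_eq, deriv_const]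
  have h_r : (fun r' => circ v r' z s) = fun _ => (0 : ℝ) := funext fun r' => hzero s hs r' z
  have h_z : (fun z' => circ v r z' s) = fun _ => (0 : ℝ) := funext fun z' => hzero s hs r z'
  rw [h_s, h_r, h_z] at hlaw
  simp only [deriv_const', mul_zero, sub_zero, add_zero, zero_sub] at hlaw
  linarith

end Summit.NavierStokesRegularity.NavierStokesRegularity.Theorems.HalfSpaceWindowDoorCirculationCarryingRigidityAngularFluxPoloidal

end
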